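import Literature.MathematicalPhysics.QuantumFieldTheory.Balaban1983to89.T4Enlargement
import Literature.MathematicalPhysics.QuantumFieldTheory.Balaban1983to89.B16SupCountCeiling
import Literature.MathematicalPhysics.QuantumFieldTheory.Balaban1983to89.B16Ineq182Gluing
import Literature.MathematicalPhysics.QuantumFieldTheory.Balaban1983to89.T4SizeLedger

/-!
# `Balaban1983to89.B16Enlargement385` — the p.385 enlargement inequality of [Balaban1989LargeFieldII]
WITH THE PRINTED CONSTANT `2(14)^d` on the cell `pub-balaban`'s sup-metric model of the linear size

statement-level skeleton of published theorems with citation tags; proofs where landed; nothing here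
is a claim about the Yang–Mills mass gap

CITATION HEADER.  Source: T. Bałaban, *Large field renormalization. II. Localization,
exponentiation, and bounds for the 𝐑 operation*, Commun. Math. Phys. **122** (1989) 355–392,
doi:10.1007/bf01238433, bib `Balaban1989LargeFieldII` (held: `paper:balaban1989-cmp122-large-field-ii`;
journal page = PDF page + 354); p. 385 [PDF 31] READ AS AN IMAGE on the x2 render
`run/shared/lean/pub/pub-balaban/b2b-balaban-ref1/pages/1989-cmp122-large-field-II/…-p031-x2.png`.
Cell `lit-balaban`, reader/typer `r13` (block B16), SKELETON row **B16.Txt@385**, geometric member.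

THE PRINTED TEXT (p. 385, between (1.81) and (1.82)), verbatim: *"Take a component Z of the region Z₁.
It is determined by some of the large field regions Z₁⁽ⁱ⁾, in the sense that the property (1.76) is
satisfied, i.e., Z ⊂ ⋃_i (Z₁⁽ⁱ⁾)~². Then d′₁(Z) ≦ Σ_i d′₁((Z₁⁽ⁱ⁾)~³), and*

  *d′₁((Z₁⁽ⁱ⁾)~³) ≦ 7^d (3·2^{d−1} d′₁(Z₁⁽ⁱ⁾) + 2^d) ≦ 2(14)^d (d′₁(Z₁⁽ⁱ⁾) + ½).*

*This implies d′₁(Z) + 1 ≦ 2(14)^d Σ_i (d′₁(Z₁⁽ⁱ⁾) + 1)"*.  The linear size `d′` is [Balaban1987RG1]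
p. 257 (*"A length of a shortest graph in this class, divided by M, is the linear size of X"*, graphs
*"contained in X and intersecting all the cubes in X"*; *"A connected family means that for every pair
□, □′ of cubes from the family there exists a sequence □, □₁, …, □_n, □′ of cubes belonging to the
family and such that two consecutive cubes have a common wall"*), `X~ⁿ` is X with n layers of cubes
adjoined (ibid.).

THE MODEL (cell `pub-balaban`, unchanged, imported): cubes indexed by `ℤᵈ` (`B13ScaleTransfer.Pt`),
print's "connected family" = `B13ScaleTransfer.FaceConnected`, one layer `B13ScaleTransfer.collar`,
`X~ⁿ = collar^[n] X` (b02's standing reading, `…B16SProfile`), the linear size `TreeLength.treeLen`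
(sup metric, infimum of lengths of admissible polygonal graphs; [Dimock2013BalabanII] App. E
convention).  On this model the sibling `…T4Enlargement` (b2b pv25) proved the enlargement inequality
in the form `d(X~³) + 1 ≤ 14^d·(4·d(X) + 1)` — constant `4·14^d` where print has `2·14^d` — from the
in-tree cube count `TreeLength.card_le_treeLen` (`|X| ≤ 2^d(4d(X) + 1)`); the later CEILING of b2b
b01, `B16.SupCountCeiling.card_le_steinerLen_two_mul_sub` (`|X| ≤ 2(2^d − 1)·ℓ̃(X) + 2^d`, every
non-empty X), had not been threaded through.

WHAT THIS MODULE PROVES (kernel-checked, no `sorry`, no new axioms, every dimension `d`).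
* §1 `card_le_ceiling_treeLen`: `|X| ≤ 2(2^d − 1)·d(X) + 2^d` for non-empty face-connected `X`
  (b01's ceiling + `TreeLength.steinerLen_le_treeLen`).  Print's middle term has `3·2^{d−1}·d′ + 2^d`
  (slope 24 at d = 4); the model's kernel ceiling is `2(2^d − 1)` (30 at d = 4) and print's slope for
  TREES is open on the model (`…B16.SupCountBranching.tree_slope_bracket_four`: 35/2 ≤ c₄ ≤ 30; cell
  DIVERGENCE D-b01g15.1) — so the MIDDLE term is NOT reproduced; but:
* §2 `treeLen_iterate_collar_le_ceiling`: `d(X~ⁿ) ≤ (2n+1)^d (2(2^d − 1) d(X) + 2^d) − 1`, and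
* §3 **THE OUTER PRINTED INEQUALITY HOLDS VERBATIM ON THE MODEL**:
  `treeLen_collar_three_le_printed : d(X~³) ≤ 2·14^d (d(X) + ½)` — because `7^d·2(2^d − 1) =
  2·14^d − 2·7^d ≤ 2·14^d` and `7^d·2^d = 14^d`; equivalently `d(X~³) + 1 ≤ 14^d (2 d(X) + 1)`
  (`treeLen_collar_three_add_one_le_printed`), halving `…T4Enlargement.treeLen_collar_three_le`'s
  constant.  It is the outer inequality, not the middle term, that the next printed display ("This
  implies …") consumes.
* §4 `hnew_collar_three_printed`: the size-ledger binder of `…T4SizeLedger.event_size_le` /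
  `foundation_size_le`, `d(P) + 2 ≤ E·(b + 1)` for born parts `P = Y~³`, with PRINT'S `E = 2·14^d`
  (the record's value; `…T4Enlargement.hnew_collar_three` has `4·14^d`); family form
  `newParts_binders_printed`.  v1.1 §7: the two-layer parts `Y~²` of (1.84) as well —
  `treeLen_collar_two_le_printed` (`d(Y~²) ≤ 2·10^d(d(Y) + ½)`), `hnew_collar_two_printed` (`E = 2·14^d`;
  `…T4Enlargement.hnew_collar_two` has `4·14^d`), mixed family form `newParts_binders_printed'`.
* §5 the knit with `…B16Ineq182Gluing` (r13): for a component determined by a non-empty finite family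
  of non-empty face-connected regions, the gluing consequence *"d′₁(Z) + 1 ≦ 2(14)^d Σ_i (d′₁(Z₁⁽ⁱ⁾) + 1)"*,
  the exponential comparison and (1.82) now carry ONE geometric binder only — the cover inequality
  `d(Z) ≤ Σ_i d((Z₁⁽ⁱ⁾)~³)` (`gluing_model`, `expProd_le_model`, `ineq182_model`).
* §6 non-vacuity: one cube.
* §8 (v1.2) THE READING `Z = ⋃_{i∈N} (Z₁⁽ⁱ⁾)~²` (resp. `~³`), face-connected: b2b pv25's foundation case
  `…T4SizeLedger.foundation_hfound` with `hnew` discharged by §7/§4 gives *"This implies d′₁(Z) + 1 ≦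
  2(14)^d Σ_i (d′₁(Z₁⁽ⁱ⁾) + 1)"*, the exponential comparison, (1.82) and the base case of (1.80)
  (`Step.Budget.Controls`) with NO geometric binder at all (`gluing_fam_collar_two/_three`,
  `expProd_le_fam_collar_two`, `ineq182_fam_collar_two`, `controls_base_fam_collar_two`).
* §9 (v1.3, append-only; r13 gen 15) THE SIX-LAYER READING of HOME `GAPS.md` G-B16-r13-01 (r13's
  `…B16Incl176Layers`, p312837: the [III] §3 construction (3.2)–(3.5)/(3.20), transcribed on the cell's
  `…B14DomainGeom` carrier, gives the next large-field region as `Z′^{~10} ∪ P′^{~6} ∪ Q′^{~4} ∪ R′^{~1}`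
  — SIX layers around the new covers where (1.76)/(1.84) print `(·)^{~2}`): the p. 385 chain and (1.82)
  ON THE MODEL for born parts `(Z₁⁽ⁱ⁾)~⁶`, `Z = ⋃_{i∈N} (Z₁⁽ⁱ⁾)~⁶` face-connected, with the constant
  `2·26^d` in place of `2·14^d` (`13^d` cubes of `□~⁶`; `treeLen_collar_six_le_model`,
  `hnew_collar_six`, `gluing_fam_collar_six`, `expProd_le_fam_collar_six`, `ineq182_fam_collar_six`,
  `controls_base_fam_collar_six`, via general-constant forms `expProd_le_const` / `ineq182_of_gluing_const`
  of r13 gen 11's `…B16Ineq182Gluing.expProd_le` / `ineq182_of_gluing`) — the kernel form of that entry's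
  «constants-only downstream»: no geometric binder, no new clause type; the located p. 385 condition reads
  `2Q ≤ ¼γ₀(26)^{−d}A₁²p₀²(g₁)` on the model (print, three layers: `(14)^{−d}`).  Nothing printed is
  asserted; which layer count print intends is the open reading question of G-B16-r13-01.

WHAT REMAINS A BINDER / A READING (named, not hidden).  The cover inequality *"d′₁(Z) ≦ Σ_i
d′₁((Z₁⁽ⁱ⁾)~³)"* for `Z ⊂ ⋃_i (Z₁⁽ⁱ⁾)~²` connected (on the model `…T4SizeLedger` §1 carries the
form with the model's join cost, `d(⋃S) + 2 ≤ Σ (d(P i) + 2)`); print's middle term (slope `3·2^{d−1}`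
for trees); the identification of print's `d′`, `X~ⁿ`, "component" with `treeLen`, `collar^[n]`,
`FaceConnected` (b02's standing model).  A model theorem about the cell's typed reading — NOT a claim
about the manuscript beyond the quoted displays, NOT summit progress.
-/

namespace Literature.MathematicalPhysics.QuantumFieldTheory.Balaban1983to89.B16Enlargement385

open Literature.MathematicalPhysics.QuantumFieldTheory.Balaban1983to89
open Literature.MathematicalPhysics.QuantumFieldTheory.Balaban1983to89.B13ScaleTransfer
open Literature.MathematicalPhysics.QuantumFieldTheory.Balaban1983to89.TreeLength
open Literature.MathematicalPhysics.QuantumFieldTheory.Balaban1983to89.B16SProfile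
open Literature.MathematicalPhysics.QuantumFieldTheory.Balaban1983to89.T4Enlargement
open Finset

noncomputable section

variable {d : ℕ}

/-! ## §1 The cube count with the kernel ceiling -/

/-- `|X| ≤ 2(2^d − 1)·d(X) + 2^d` for a non-empty face-connected family of cubes: b01's ceiling
`B16.SupCountCeiling.card_le_steinerLen_two_mul_sub` (Steiner length) and `ℓ̃ ≤ d`
(`TreeLength.steinerLen_le_treeLen`).  Print's cube count behind the middle term of the p. 385 display
has slope `3·2^{d−1}`; this is the model's kernel ceiling `2(2^d − 1)` instead — the cube-count step of
the printed display with the MODEL constant, not print's.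
[cite: Balaban1989LargeFieldII, p.385 display after (1.81) (cube-count step; model constant 2(2^d−1) for print's 3·2^{d−1})] -/
theorem card_le_ceiling_treeLen {X : Finset (Pt d)} (hX : X.Nonempty) (hXc : FaceConnected X) :
    (X.card : ℝ) ≤ 2 * (2 ^ d - 1) * treeLen X + 2 ^ d := by
  have h1 := B16.SupCountCeiling.card_le_steinerLen_two_mul_sub hX
  have h2 := steinerLen_le_treeLen hX hXc
  have hc : (0 : ℝ) ≤ 2 * (2 ^ d - 1) := by
    have : (1 : ℝ) ≤ 2 ^ d := one_le_pow₀ (by norm_num)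
    linarith
  nlinarith [mul_le_mul_of_nonneg_left h2 hc]

/-! ## §2 `n` layers -/

/-- `d(X~ⁿ) ≤ (2n+1)^d·(2(2^d − 1)·d(X) + 2^d) − 1` for a non-empty face-connected `X`: (2.30) upper half
`TreeLength.treeLen_le_card_sub_one` on `X~ⁿ` (face-connected by `B16SProfile.faceConnected_iterate_collar`),
the enlargement count `T4Enlargement.card_iterate_collar_le` (`|X~ⁿ| ≤ (2n+1)^d |X|`), and §1 — print's
first inequality `d′((·)~³) ≤ 7^d(…)` for general `n`, with the model constant in the bracket.
[cite: Balaban1989LargeFieldII, p.385 display after (1.81) (first inequality; n layers, model constant)] -/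
theorem treeLen_iterate_collar_le_ceiling (n : ℕ) {X : Finset (Pt d)} (hX : X.Nonempty)
    (hXc : FaceConnected X) :
    treeLen (collar^[n] X) ≤ (2 * n + 1) ^ d * (2 * (2 ^ d - 1) * treeLen X + 2 ^ d) - 1 := by
  have h1 := treeLen_le_card_sub_one (iterate_collar_nonempty n hX) (faceConnected_iterate_collar n hXc)
  have h2 : ((collar^[n] X).card : ℝ) ≤ (2 * n + 1) ^ d * (X.card : ℝ) := by
    exact_mod_cast card_iterate_collar_le n X
  have h3 := card_le_ceiling_treeLen hX hXc
  have hp : (0 : ℝ) ≤ (2 * n + 1) ^ d := by positivity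
  nlinarith [mul_le_mul_of_nonneg_left h3 hp]

/-! ## §3 Three layers: the outer printed inequality, verbatim on the model -/

/-- **p. 385, the OUTER inequality, ON THE MODEL**: `d(X~³) ≤ 2·14^d·(d(X) + ½)` for every non-empty
face-connected family of cubes `X` ⊂ ℤᵈ, every `d` — print: *"d′₁((Z₁⁽ⁱ⁾)~³) ≦ … ≦ 2(14)^d(d′₁(Z₁⁽ⁱ⁾) + ½)"*.
From §2 at `n = 3`: `7^d(2(2^d − 1)x + 2^d) − 1 = 2·14^d·x + 14^d − 2·7^d·x − 1 ≤ 2·14^d(x + ½)`.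
[cite: Balaban1989LargeFieldII, p.385 display after (1.81) (outer inequality)] -/
theorem treeLen_collar_three_le_printed {X : Finset (Pt d)} (hX : X.Nonempty) (hXc : FaceConnected X) :
    treeLen (collar^[3] X) ≤ 2 * 14 ^ d * (treeLen X + 1 / 2) := by
  have h := treeLen_iterate_collar_le_ceiling 3 hX hXc
  have e7 : ((2 : ℝ) * (3 : ℕ) + 1) ^ d = 7 ^ d := by norm_num
  have e14 : (14 : ℝ) ^ d = 7 ^ d * 2 ^ d := by rw [← mul_pow]; norm_num
  rw [e7] at h
  have h0 : 0 ≤ treeLen X := treeLen_nonneg X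
  have h7 : (0 : ℝ) ≤ 7 ^ d := by positivity
  rw [e14]
  nlinarith [mul_nonneg h7 h0]

/-- The same as print's next-line shape `d(X~³) + 1 ≤ 14^d·(2·d(X) + 1)` — halving the constant of
`T4Enlargement.treeLen_collar_three_le` (`14^d·(4·d(X) + 1)`).
[cite: Balaban1989LargeFieldII, p.385 display after (1.81) (outer inequality)] -/
theorem treeLen_collar_three_add_one_le_printed {X : Finset (Pt d)} (hX : X.Nonempty)
    (hXc : FaceConnected X) : treeLen (collar^[3] X) + 1 ≤ 14 ^ d * (2 * treeLen X + 1) := by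
  have h := treeLen_iterate_collar_le_ceiling 3 hX hXc
  have e7 : ((2 : ℝ) * (3 : ℕ) + 1) ^ d = 7 ^ d := by norm_num
  have e14 : (14 : ℝ) ^ d = 7 ^ d * 2 ^ d := by rw [← mul_pow]; norm_num
  rw [e7] at h
  have h0 : 0 ≤ treeLen X := treeLen_nonneg X
  have h7 : (0 : ℝ) ≤ 7 ^ d := by positivity
  rw [e14]
  nlinarith [mul_nonneg h7 h0]

/-! ## §4 The size-ledger binder with print's constant `E = 2·14^d` -/

/-- **THE BINDER `hnew` OF `T4SizeLedger.event_size_le` / `foundation_size_le` WITH PRINT'S CONSTANT**: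
`d(Y~³) + 2 ≤ 2·14^d·(d(Y) + 1)` for `Y` non-empty face-connected (`T4Enlargement.hnew_collar_three`
has `4·14^d`; the record `t4/T4-EST-U5E-rem.md` §4 and print use `E = 2·14^d`).
[cite: Balaban1989LargeFieldII, p.385 display after (1.81) (outer inequality)] -/
theorem hnew_collar_three_printed {Y : Finset (Pt d)} (hY : Y.Nonempty) (hYc : FaceConnected Y) :
    treeLen (collar^[3] Y) + 2 ≤ 2 * 14 ^ d * (treeLen Y + 1) := by
  have h := treeLen_iterate_collar_le_ceiling 3 hY hYc
  have e7 : ((2 : ℝ) * (3 : ℕ) + 1) ^ d = 7 ^ d := by norm_num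
  have e14 : (14 : ℝ) ^ d = 7 ^ d * 2 ^ d := by rw [← mul_pow]; norm_num
  rw [e7] at h
  have h0 : 0 ≤ treeLen Y := treeLen_nonneg Y
  have h7 : (1 : ℝ) ≤ 7 ^ d := one_le_pow₀ (by norm_num)
  have h2 : (1 : ℝ) ≤ 2 ^ d := one_le_pow₀ (by norm_num)
  rw [e14]
  nlinarith [mul_nonneg (by linarith : (0 : ℝ) ≤ 7 ^ d) h0, mul_le_mul h7 h2 zero_le_one (by linarith)]

/-- THE FAMILY FORM with print's constant: for born parts `P i = (Y i)~³` (`i ∈ N`, each `Y i` non-empty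
face-connected) both premises of `T4SizeLedger.foundation_size_le` about the parts hold on the model —
`hP` (admissible graphs, `T4Enlargement.admissible_iterate_collar`) and `hnew` with `E = 2·14^d`.
[cite: Balaban1989LargeFieldII, p.385 display after (1.81) (outer inequality, family form)] -/
theorem newParts_binders_printed {ι : Type*} (Y : ι → Finset (Pt d)) (N : Finset ι)
    (hY : ∀ i ∈ N, (Y i).Nonempty) (hYc : ∀ i ∈ N, FaceConnected (Y i)) :
    (∀ i ∈ N, ∃ T, Admissible (collar^[3] (Y i)) T) ∧
      ∀ i ∈ N, treeLen (collar^[3] (Y i)) + 2 ≤ 2 * 14 ^ d * (treeLen (Y i) + 1) :=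
  ⟨fun i hi => admissible_iterate_collar 3 (hY i hi) (hYc i hi),
    fun i hi => hnew_collar_three_printed (hY i hi) (hYc i hi)⟩

/-! ## §5 The knit with the printed arithmetic of `B16Ineq182Gluing`: one geometric binder left -/

/-- p. 385 *"This implies d′₁(Z) + 1 ≦ 2(14)^d Σ_i (d′₁(Z₁⁽ⁱ⁾) + 1)"* ON THE MODEL: for a component of size
`dZ` determined by a non-empty finite family of non-empty face-connected regions `Z i`, given only the
COVER INEQUALITY `dZ ≤ Σ_i d((Z i)~³)` as a binder (`hcover`), the per-region enlargement bound being §3.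
[cite: Balaban1989LargeFieldII, p.385 display after (1.81)] -/
theorem gluing_model {ι : Type*} {s : Finset ι} (hs : s.Nonempty) {Z : ι → Finset (Pt d)}
    (hZ : ∀ i ∈ s, (Z i).Nonempty) (hZc : ∀ i ∈ s, FaceConnected (Z i)) {dZ : ℝ}
    (hcover : dZ ≤ ∑ i ∈ s, treeLen (collar^[3] (Z i))) :
    dZ + 1 ≤ 2 * 14 ^ d * ∑ i ∈ s, (treeLen (Z i) + 1) :=
  B16Ineq182Gluing.gluing hs hcover fun i hi => treeLen_collar_three_le_printed (hZ i hi) (hZc i hi)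

/-- The exponential comparison of p. 385 ON THE MODEL, cover inequality as the only geometric binder.
[cite: Balaban1989LargeFieldII, p.385 display before (1.82)] -/
theorem expProd_le_model {ι : Type*} {s : Finset ι} (hs : s.Nonempty) {Z : ι → Finset (Pt d)}
    (hZ : ∀ i ∈ s, (Z i).Nonempty) (hZc : ∀ i ∈ s, FaceConnected (Z i)) {dZ γ₀ A₁ p₀g : ℝ}
    (hγ : 0 ≤ γ₀) (hcover : dZ ≤ ∑ i ∈ s, treeLen (collar^[3] (Z i))) :
    ∏ i ∈ s, Real.exp (-(1 / 2) * γ₀ * A₁ ^ 2 * p₀g ^ 2 * (treeLen (Z i) + 1)) ≤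
      Real.exp (-(1 / 4) * γ₀ * (14 ^ d)⁻¹ * A₁ ^ 2 * p₀g ^ 2 * (dZ + 1)) :=
  B16Ineq182Gluing.expProd_le hγ (gluing_model hs hZ hZc hcover)

/-- (1.82) ON THE MODEL from the (1.79)-shaped definition of `κ₁(Z)` (`hdef`) with the cover inequality
as the only geometric binder. [cite: Balaban1989LargeFieldII, (1.82) p.385] -/
theorem ineq182_model {ι : Type*} {s : Finset ι} (hs : s.Nonempty) {Z : ι → Finset (Pt d)}
    (hZ : ∀ i ∈ s, (Z i).Nonempty) (hZc : ∀ i ∈ s, FaceConnected (Z i)) {κ₁ dZ γ₀ A₁ p₀g cost : ℝ}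
    (hγ : 0 ≤ γ₀)
    (hdef : ∑ i ∈ s, (1 / 2) * γ₀ * A₁ ^ 2 * p₀g ^ 2 * (treeLen (Z i) + 1) - cost ≤ κ₁)
    (hcover : dZ ≤ ∑ i ∈ s, treeLen (collar^[3] (Z i))) :
    (1 / 4) * γ₀ * (14 ^ d)⁻¹ * A₁ ^ 2 * p₀g ^ 2 * (dZ + 1) - cost ≤ κ₁ :=
  B16Ineq182Gluing.ineq182_of_gluing hγ hdef (gluing_model hs hZ hZc hcover)

/-! ## §6 Non-vacuity -/

/-- One cube (`d(X) = 0`, `TreeLength.treeLen_singleton`): `d({x}~³) ≤ 14^d`. [folklore] -/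
example (x : Pt d) : treeLen (collar^[3] ({x} : Finset (Pt d))) ≤ 14 ^ d := by
  have hc : FaceConnected ({x} : Finset (Pt d)) := by
    intro a ha b hb
    rw [Finset.mem_singleton] at ha hb
    subst ha; subst hb
    exact Relation.ReflTransGen.refl
  have h := treeLen_collar_three_le_printed (Finset.singleton_nonempty x) hc
  rw [treeLen_singleton] at h
  linarith

/-! ## §7 (v1.1, append-only) Two layers: the born parts `(Z_{j+1}⁽ⁱ⁾)~²` of (1.84)

p. 386, general step: *"Z ⊂ ⋃_n (Z_j⁽ⁿ⁾)′~¹⁰ ∪ ⋃_i (Z_{j+1}⁽ⁱ⁾)~². (1.84)"* and *"The statement (1.80)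
holds also for X and κ_{j+1}(X), because there is the exactly one domain in X"* / *"We have proved
(1.80), if this number is equal to 1, because then we have either the situation covered by (1.83), or
by the first induction step"* — for a single NEW region the first induction step (p. 385) is invoked
by reference, i.e. its enlargement inequality is used for the two-layer parts of (1.84) as well.  On
the model the same route as §3 (b01's ceiling through the enlargement count) gives it with a constant
BELOW print's three-layer one. -/

/-- Two layers, ON THE MODEL: `d(X~²) ≤ 2·10^d·(d(X) + ½)` for every non-empty face-connected `X`
(`5^d·2(2^d − 1) = 2·10^d − 2·5^d`, `5^d·2^d = 10^d`) — the enlargement inequality of the first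
induction step for the two-layer parts `(Z_{j+1}⁽ⁱ⁾)~²` of (1.84), invoked on p. 386 by reference.
[cite: Balaban1989LargeFieldII, (1.84) p.386 with p.385 display after (1.81) (two-layer parts, model)] -/
theorem treeLen_collar_two_le_printed {X : Finset (Pt d)} (hX : X.Nonempty) (hXc : FaceConnected X) :
    treeLen (collar^[2] X) ≤ 2 * 10 ^ d * (treeLen X + 1 / 2) := by
  have h := treeLen_iterate_collar_le_ceiling 2 hX hXc
  have e5 : ((2 : ℝ) * (2 : ℕ) + 1) ^ d = 5 ^ d := by norm_num
  have e10 : (10 : ℝ) ^ d = 5 ^ d * 2 ^ d := by rw [← mul_pow]; norm_num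
  rw [e5] at h
  have h0 : 0 ≤ treeLen X := treeLen_nonneg X
  have h5 : (0 : ℝ) ≤ 5 ^ d := by positivity
  rw [e10]
  nlinarith [mul_nonneg h5 h0]

/-- Two layers, the size-ledger binder with PRINT'S constant: `d(Y~²) + 2 ≤ 2·14^d·(d(Y) + 1)` for `Y`
non-empty face-connected (via `10^d ≤ 14^d`; `T4Enlargement.hnew_collar_two` has `4·14^d`) — so BOTH
kinds of born parts of (1.84), `Y~²` and `Y~³` (§4), meet `T4SizeLedger`'s `hnew` with `E = 2·14^d`.
[cite: Balaban1989LargeFieldII, (1.84) p.386 with p.385 display after (1.81) (two-layer parts, model)] -/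
theorem hnew_collar_two_printed {Y : Finset (Pt d)} (hY : Y.Nonempty) (hYc : FaceConnected Y) :
    treeLen (collar^[2] Y) + 2 ≤ 2 * 14 ^ d * (treeLen Y + 1) := by
  have h := treeLen_iterate_collar_le_ceiling 2 hY hYc
  have e5 : ((2 : ℝ) * (2 : ℕ) + 1) ^ d = 5 ^ d := by norm_num
  have e10 : (10 : ℝ) ^ d = 5 ^ d * 2 ^ d := by rw [← mul_pow]; norm_num
  rw [e5] at h
  have h0 : 0 ≤ treeLen Y := treeLen_nonneg Y
  have h5 : (0 : ℝ) ≤ 5 ^ d := by positivity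
  have h14 : (1 : ℝ) ≤ 14 ^ d := one_le_pow₀ (by norm_num)
  have h1014 : (10 : ℝ) ^ d ≤ 14 ^ d := pow_le_pow_left₀ (by norm_num) (by norm_num) d
  -- `d(Y~²) ≤ 2·10^d·y − 2·5^d·y + 10^d − 1` (from `h`), then `10^d + 1 ≤ 2·14^d`, `10^d·y ≤ 14^d·y`
  have h' : treeLen (collar^[2] Y) ≤ 2 * 10 ^ d * treeLen Y + 10 ^ d - 1 := by
    rw [e10]; nlinarith [mul_nonneg h5 h0]
  nlinarith [mul_le_mul_of_nonneg_right h1014 h0]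

/-- Family form for mixed born parts: each part is `(Y i)~²` or `(Y i)~³` (`layers i ∈ {2, 3}`), each
`Y i` non-empty face-connected ⇒ admissible graphs exist and `hnew` holds with `E = 2·14^d`.
[cite: Balaban1989LargeFieldII, (1.84) p.386 with p.385 display after (1.81) (born parts, model)] -/
theorem newParts_binders_printed' {ι : Type*} (Y : ι → Finset (Pt d)) (layers : ι → ℕ) (N : Finset ι)
    (hY : ∀ i ∈ N, (Y i).Nonempty) (hYc : ∀ i ∈ N, FaceConnected (Y i))
    (hl : ∀ i ∈ N, layers i = 2 ∨ layers i = 3) :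
    (∀ i ∈ N, ∃ T, Admissible (collar^[layers i] (Y i)) T) ∧
      ∀ i ∈ N, treeLen (collar^[layers i] (Y i)) + 2 ≤ 2 * 14 ^ d * (treeLen (Y i) + 1) := by
  refine ⟨fun i hi => admissible_iterate_collar _ (hY i hi) (hYc i hi), fun i hi => ?_⟩
  rcases hl i hi with h | h <;> rw [h]
  · exact hnew_collar_two_printed (hY i hi) (hYc i hi)
  · exact hnew_collar_three_printed (hY i hi) (hYc i hi)

/-! ## §8 (v1.2, append-only) «This implies d′₁(Z) + 1 ≦ 2(14)^d Σ_i (d′₁(Z₁⁽ⁱ⁾) + 1)» WITHOUT geometric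
binders, for the component read as the union of its enlarged regions

p. 385: *"Take a component Z of the region Z₁. It is determined by some of the large field regions Z₁⁽ⁱ⁾,
in the sense that the property (1.76) is satisfied, i.e., Z ⊂ ⋃_i (Z₁⁽ⁱ⁾)~². … This implies
d′₁(Z) + 1 ≦ 2(14)^d Σ_i (d′₁(Z₁⁽ⁱ⁾) + 1)"*.  READING (the model's, stated not hidden): the component
IS the union of the two-layer (resp. three-layer) enlargements of the regions determining it,
`Z = ⋃_{i∈N} (Y i)~ⁿ` (`B16MergeGeometry.fam`), and is face-connected (print's "connected family",
[Balaban1987RG1] p. 257).  Then b2b pv25's size-ledger foundation case `T4SizeLedger.foundation_hfound`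
(sum form of the merge-step geometry, join cost 2 per part, tree-connectedness of the touch graph from
the face-connectedness of the union by `B16MergeGeometry.gconn_touchGraph_of_faceConnected`) with the
binder `hnew` DISCHARGED by §4/§7 gives the printed display with NO geometric binder left; the cover
inequality of p. 385 is not needed in this reading (it is replaced by the model's sum form). -/

section Union

variable {ι : Type*} [DecidableEq ι]

open B16MergeGeometry in
omit [DecidableEq ι] in
/-- The touch graph of a family of non-empty parts whose union is face-connected is connected on any
non-empty index set (`B16MergeGeometry.gconn_touchGraph_of_faceConnected` with `Z` = the union itself;
the «every member meets Z» premise is automatic). [folklore] -/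
private theorem gconn_of_faceConnected_fam {P : ι → Finset (Pt d)} (hP : ∀ i, (P i).Nonempty)
    {N : Finset ι} (hN : N.Nonempty) (hU : FaceConnected (fam P N)) :
    Step.Budget.GConn (touchGraph P) N := by
  refine gconn_touchGraph_of_faceConnected P hU (Finset.Subset.refl _) (fun i hi => ?_) hN
  obtain ⟨z, hz⟩ := hP i
  exact ⟨z, subset_fam P hi hz, hz⟩

open B16MergeGeometry in
/-- **p. 385 «This implies d′₁(Z) + 1 ≦ 2(14)^d Σ_i (d′₁(Z₁⁽ⁱ⁾) + 1)» ON THE MODEL, NO GEOMETRIC BINDER**,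
two-layer reading: for non-empty face-connected regions `Y i` and a non-empty index set `N` whose union of
two-layer enlargements `Z = ⋃_{i∈N} (Y i)~²` is face-connected,
`d(Z) + 1 ≤ 2·14^d Σ_{i∈N} (d(Y i) + 1)` — `T4SizeLedger.foundation_hfound` with `hnew` = §7
`hnew_collar_two_printed`. [cite: Balaban1989LargeFieldII, p.385 display before (1.82) («This implies …»; model, two-layer reading)] -/
theorem gluing_fam_collar_two {Y : ι → Finset (Pt d)} (hY : ∀ i, (Y i).Nonempty)
    (hYc : ∀ i, FaceConnected (Y i)) {N : Finset ι} (hN : N.Nonempty)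
    (hU : FaceConnected (fam (fun i => collar^[2] (Y i)) N)) :
    treeLen (fam (fun i => collar^[2] (Y i)) N) + 1 ≤ 2 * 14 ^ d * ∑ i ∈ N, (treeLen (Y i) + 1) :=
  T4SizeLedger.foundation_hfound (fun i => admissible_iterate_collar 2 (hY i) (hYc i))
    (gconn_of_faceConnected_fam (fun i => iterate_collar_nonempty 2 (hY i)) hN hU)
    fun i _ => hnew_collar_two_printed (hY i) (hYc i)

open B16MergeGeometry in
/-- The same, three-layer reading `Z = ⋃_{i∈N} (Y i)~³` (`hnew` = §4 `hnew_collar_three_printed`).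
[cite: Balaban1989LargeFieldII, p.385 display before (1.82) («This implies …»; model, three-layer reading)] -/
theorem gluing_fam_collar_three {Y : ι → Finset (Pt d)} (hY : ∀ i, (Y i).Nonempty)
    (hYc : ∀ i, FaceConnected (Y i)) {N : Finset ι} (hN : N.Nonempty)
    (hU : FaceConnected (fam (fun i => collar^[3] (Y i)) N)) :
    treeLen (fam (fun i => collar^[3] (Y i)) N) + 1 ≤ 2 * 14 ^ d * ∑ i ∈ N, (treeLen (Y i) + 1) :=
  T4SizeLedger.foundation_hfound (fun i => admissible_iterate_collar 3 (hY i) (hYc i))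
    (gconn_of_faceConnected_fam (fun i => iterate_collar_nonempty 3 (hY i)) hN hU)
    fun i _ => hnew_collar_three_printed (hY i) (hYc i)

open B16MergeGeometry in
/-- The exponential comparison of p. 385 ON THE MODEL with no geometric binder (two-layer reading):
`Π_{i∈N} exp(−½γ₀A₁²p₀²(d(Y i)+1)) ≤ exp(−¼γ₀(14^d)⁻¹A₁²p₀²(d(Z)+1))`, `Z = ⋃_{i∈N} (Y i)~²`.
[cite: Balaban1989LargeFieldII, p.385 display before (1.82) (exponential comparison; model, two-layer reading)] -/
theorem expProd_le_fam_collar_two {Y : ι → Finset (Pt d)} (hY : ∀ i, (Y i).Nonempty)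
    (hYc : ∀ i, FaceConnected (Y i)) {N : Finset ι} (hN : N.Nonempty)
    (hU : FaceConnected (fam (fun i => collar^[2] (Y i)) N)) {γ₀ A₁ p₀g : ℝ} (hγ : 0 ≤ γ₀) :
    ∏ i ∈ N, Real.exp (-(1 / 2) * γ₀ * A₁ ^ 2 * p₀g ^ 2 * (treeLen (Y i) + 1)) ≤
      Real.exp (-(1 / 4) * γ₀ * (14 ^ d)⁻¹ * A₁ ^ 2 * p₀g ^ 2 *
        (treeLen (fam (fun i => collar^[2] (Y i)) N) + 1)) :=
  B16Ineq182Gluing.expProd_le hγ (gluing_fam_collar_two hY hYc hN hU)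

open B16MergeGeometry in
/-- **(1.82) ON THE MODEL WITH NO GEOMETRIC BINDER** (two-layer reading): from the (1.79)-shaped
definition of `κ₁(Z)` (`hdef`, cost `cost = O(1)M^dR₁^{d+1}d′₁(Z)`) alone,
`¼γ₀(14^d)⁻¹A₁²p₀²(d(Z) + 1) − cost ≤ κ₁`, `Z = ⋃_{i∈N} (Y i)~²` face-connected.
[cite: Balaban1989LargeFieldII, (1.82) p.385 (model, two-layer reading)] -/
theorem ineq182_fam_collar_two {Y : ι → Finset (Pt d)} (hY : ∀ i, (Y i).Nonempty)
    (hYc : ∀ i, FaceConnected (Y i)) {N : Finset ι} (hN : N.Nonempty)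
    (hU : FaceConnected (fam (fun i => collar^[2] (Y i)) N)) {κ₁ γ₀ A₁ p₀g cost : ℝ} (hγ : 0 ≤ γ₀)
    (hdef : ∑ i ∈ N, (1 / 2) * γ₀ * A₁ ^ 2 * p₀g ^ 2 * (treeLen (Y i) + 1) - cost ≤ κ₁) :
    (1 / 4) * γ₀ * (14 ^ d)⁻¹ * A₁ ^ 2 * p₀g ^ 2 *
        (treeLen (fam (fun i => collar^[2] (Y i)) N) + 1) - cost ≤ κ₁ :=
  B16Ineq182Gluing.ineq182_of_gluing hγ hdef (gluing_fam_collar_two hY hYc hN hU)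

open B16MergeGeometry in
/-- **THE BASE CASE `j = 1` OF (1.80) ON THE MODEL**, two-layer reading, no geometric binder:
`Step.Budget.base_182` with `hκ` discharged by `ineq182_fam_collar_two`; remaining hypotheses are the
(1.81) majorant `Q(d(Z)+1)` for the right-hand side of (1.80) and for the cost, and the located condition
`2Q ≤ ¼γ₀(14)^{−d}A₁²p₀²(g₁)`. [cite: Balaban1989LargeFieldII, (1.80)–(1.82) pp.384–385 (model, two-layer reading)] -/
theorem controls_base_fam_collar_two (b : Step.Budget.Consts) (hbd : b.d = d) {Y : ι → Finset (Pt d)}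
    (hY : ∀ i, (Y i).Nonempty) (hYc : ∀ i, FaceConnected (Y i)) {N : Finset ι} (hN : N.Nonempty)
    (hU : FaceConnected (fam (fun i => collar^[2] (Y i)) N)) {κ₁ γ₀ A₁ p₀g Q : ℝ} {K : ℕ}
    {size : ℕ → ℝ} (hγ : 0 ≤ γ₀)
    (hdef : ∑ i ∈ N, (1 / 2) * γ₀ * A₁ ^ 2 * p₀g ^ 2 * (treeLen (Y i) + 1) -
      b.cost 1 (treeLen (fam (fun i => collar^[2] (Y i)) N)) ≤ κ₁)
    (h181 : ∑ n ∈ Finset.Ioc 1 (1 + K), b.cost n (size n) ≤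
      Q * (treeLen (fam (fun i => collar^[2] (Y i)) N) + 1))
    (hcost : b.cost 1 (treeLen (fam (fun i => collar^[2] (Y i)) N)) ≤
      Q * (treeLen (fam (fun i => collar^[2] (Y i)) N) + 1))
    (hcond : 2 * Q ≤ (1 / 4) * γ₀ * (14 ^ b.d)⁻¹ * A₁ ^ 2 * p₀g ^ 2) :
    Step.Budget.Controls b 1 K κ₁ size := by
  subst hbd
  exact Step.Budget.base_182 κ₁ ((1 / 4) * γ₀ * (14 ^ b.d)⁻¹ * A₁ ^ 2 * p₀g ^ 2) Q _ _ _
    (treeLen_nonneg _) (ineq182_fam_collar_two hY hYc hN hU hγ hdef) h181 hcost hcond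

end Union

/-! ## §9 (v1.3, append-only, r13 gen 15) Six-layer born parts — the alternative layer count of HOME
`GAPS.md` G-B16-r13-01 (r13's `…B16Incl176Layers`, p312837)

[Balaban1989LargeFieldII] (1.76) p. 381 / (1.84) p. 386 print `(Z_j⁽ⁱ⁾)~²` around the new large-field covers,
and p. 385 converts sizes through `(Z₁⁽ⁱ⁾)~³`; the [III] §3 construction ((3.2)–(3.5) p. 264–265, (3.20)
p. 269 of [Balaban1988Convergent]), transcribed on the cell's `…B14DomainGeom` carrier, puts SIX layers of
the new `P`-covers (four of the `Q`-covers) into the next large-field region (`…B16Incl176Layers.largeField_next_eq`,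
exact).  This section records, ON THE MODEL and with NO geometric binder, that the p. 385 chain, the
exponential comparison, (1.82) and the base case of (1.80) go through unchanged in SHAPE for six-layer born
parts, with `2·26^d` (`13^d = |□~⁶|` times the kernel ceiling) where print has `2(14)^d` — constants only.
Nothing printed is asserted; which count print intends is G-B16-r13-01's open reading question. -/

section Six

variable {ι : Type*} [DecidableEq ι]

omit [DecidableEq ι] in
/-- General-constant form of r13 gen 11's `B16Ineq182Gluing.expProd_le`: from a gluing consequence
`dZ + 1 ≤ 2c·Σ_i (d_i + 1)` with any `c > 0`, the exponential comparison
`Π_i exp(−½γ₀A₁²p₀²(d_i + 1)) ≤ exp(−¼γ₀c⁻¹A₁²p₀²(dZ + 1))` (print: `c = 14^d`). PROVED (arithmetic).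
[cite: Balaban1989LargeFieldII, p.385 display before (1.82) (exponential comparison; general constant)] -/
theorem expProd_le_const {s : Finset ι} {c dZ γ₀ A₁ p₀g : ℝ} {d₁ : ι → ℝ} (hc : 0 < c) (hγ : 0 ≤ γ₀)
    (hglue : dZ + 1 ≤ 2 * c * ∑ i ∈ s, (d₁ i + 1)) :
    ∏ i ∈ s, Real.exp (-(1 / 2) * γ₀ * A₁ ^ 2 * p₀g ^ 2 * (d₁ i + 1)) ≤
      Real.exp (-(1 / 4) * γ₀ * c⁻¹ * A₁ ^ 2 * p₀g ^ 2 * (dZ + 1)) := by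
  rw [← Real.exp_sum, Real.exp_le_exp, ← Finset.mul_sum]
  have hk : 0 ≤ γ₀ * A₁ ^ 2 * p₀g ^ 2 := by positivity
  have hq : c⁻¹ * (dZ + 1) ≤ 2 * ∑ i ∈ s, (d₁ i + 1) := by
    rw [inv_mul_le_iff₀ hc]; linarith
  have := mul_le_mul_of_nonneg_left hq hk
  nlinarith

omit [DecidableEq ι] in
/-- General-constant form of `B16Ineq182Gluing.ineq182_of_gluing`: (1.82) from the (1.79)-shaped definition
of `κ₁(Z)` (`hdef`) and a gluing consequence with any constant `c > 0`:
`¼γ₀c⁻¹A₁²p₀²(dZ + 1) − cost ≤ κ₁` (print: `c = 14^d`). PROVED (arithmetic). [cite: Balaban1989LargeFieldII,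
(1.82) p.385 (general constant)] -/
theorem ineq182_of_gluing_const {s : Finset ι} {c κ₁ dZ γ₀ A₁ p₀g cost : ℝ} {d₁ : ι → ℝ} (hc : 0 < c)
    (hγ : 0 ≤ γ₀) (hdef : ∑ i ∈ s, (1 / 2) * γ₀ * A₁ ^ 2 * p₀g ^ 2 * (d₁ i + 1) - cost ≤ κ₁)
    (hglue : dZ + 1 ≤ 2 * c * ∑ i ∈ s, (d₁ i + 1)) :
    (1 / 4) * γ₀ * c⁻¹ * A₁ ^ 2 * p₀g ^ 2 * (dZ + 1) - cost ≤ κ₁ := by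
  rw [← Finset.mul_sum] at hdef
  have hk : 0 ≤ γ₀ * A₁ ^ 2 * p₀g ^ 2 := by positivity
  have hq : c⁻¹ * (dZ + 1) ≤ 2 * ∑ i ∈ s, (d₁ i + 1) := by
    rw [inv_mul_le_iff₀ hc]; linarith
  have := mul_le_mul_of_nonneg_left hq hk
  nlinarith

/-- Six layers on the model: `d(X~⁶) ≤ 2·26^d·(d(X) + ½)` for `X` non-empty face-connected (§2 with
`n = 6`: `13^d·2(2^d − 1) ≤ 2·26^d`, `13^d·2^d = 26^d`) — the model counterpart of print's three-layer
`2(14)^d(d′ + ½)` under the six-layer count. [cite: Balaban1989LargeFieldII, p.385 display after (1.81)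
(outer inequality; six-layer reading, model constant 26 for 14)] -/
theorem treeLen_collar_six_le_model {X : Finset (Pt d)} (hX : X.Nonempty) (hXc : FaceConnected X) :
    treeLen (collar^[6] X) ≤ 2 * 26 ^ d * (treeLen X + 1 / 2) := by
  have h := treeLen_iterate_collar_le_ceiling 6 hX hXc
  have e13 : ((2 : ℝ) * (6 : ℕ) + 1) ^ d = 13 ^ d := by norm_num
  have e26 : (26 : ℝ) ^ d = 13 ^ d * 2 ^ d := by rw [← mul_pow]; norm_num
  rw [e13] at h
  have h0 : 0 ≤ treeLen X := treeLen_nonneg X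
  have h13 : (0 : ℝ) ≤ 13 ^ d := by positivity
  rw [e26]
  nlinarith [mul_nonneg h13 h0]

/-- The size-ledger binder for SIX-layer born parts: `d(Y~⁶) + 2 ≤ 2·26^d·(d(Y) + 1)` for `Y` non-empty
face-connected (general-`E` form of `T4SizeLedger.foundation_size_le`; print's three-layer parts have
`E = 2·14^d`, §4). [cite: Balaban1989LargeFieldII, p.385 display after (1.81) (six-layer reading, model)] -/
theorem hnew_collar_six {Y : Finset (Pt d)} (hY : Y.Nonempty) (hYc : FaceConnected Y) :
    treeLen (collar^[6] Y) + 2 ≤ 2 * 26 ^ d * (treeLen Y + 1) := by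
  have h := treeLen_iterate_collar_le_ceiling 6 hY hYc
  have e13 : ((2 : ℝ) * (6 : ℕ) + 1) ^ d = 13 ^ d := by norm_num
  have e26 : (26 : ℝ) ^ d = 13 ^ d * 2 ^ d := by rw [← mul_pow]; norm_num
  rw [e13] at h
  have h0 : 0 ≤ treeLen Y := treeLen_nonneg Y
  have h13 : (0 : ℝ) ≤ 13 ^ d := by positivity
  have h1 : (1 : ℝ) ≤ 13 ^ d * 2 ^ d := by
    rw [← e26]; exact one_le_pow₀ (by norm_num)
  -- `d(Y~⁶) ≤ 2·13^d2^d·y − 2·13^d·y + 13^d2^d − 1` (from `h`), then `13^d2^d + 1 ≤ 2·13^d2^d`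
  rw [e26]
  nlinarith [mul_nonneg h13 h0]

open B16MergeGeometry in
/-- **p. 385 «This implies d′₁(Z) + 1 ≦ 2(14)^d Σ_i (d′₁(Z₁⁽ⁱ⁾) + 1)» ON THE MODEL, SIX-LAYER READING, NO
GEOMETRIC BINDER**: for non-empty face-connected regions `Y i` and a non-empty index set `N` whose union of
six-layer enlargements `Z = ⋃_{i∈N} (Y i)~⁶` is face-connected, `d(Z) + 1 ≤ 2·26^d Σ_{i∈N} (d(Y i) + 1)`
(`T4SizeLedger.foundation_size_le` with `E = 2·26^d`). [cite: Balaban1989LargeFieldII, p.385 display before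
(1.82) («This implies …»; model, six-layer reading)] -/
theorem gluing_fam_collar_six {Y : ι → Finset (Pt d)} (hY : ∀ i, (Y i).Nonempty)
    (hYc : ∀ i, FaceConnected (Y i)) {N : Finset ι} (hN : N.Nonempty)
    (hU : FaceConnected (fam (fun i => collar^[6] (Y i)) N)) :
    treeLen (fam (fun i => collar^[6] (Y i)) N) + 1 ≤ 2 * 26 ^ d * ∑ i ∈ N, (treeLen (Y i) + 1) := by
  have h := T4SizeLedger.foundation_size_le (fun i => admissible_iterate_collar 6 (hY i) (hYc i))
    (gconn_of_faceConnected_fam (fun i => iterate_collar_nonempty 6 (hY i)) hN hU)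
    (E := 2 * 26 ^ d) (b := fun i => treeLen (Y i)) fun i _ => hnew_collar_six (hY i) (hYc i)
  linarith

open B16MergeGeometry in
/-- The exponential comparison ON THE MODEL, six-layer reading, no geometric binder:
`Π_{i∈N} exp(−½γ₀A₁²p₀²(d(Y i)+1)) ≤ exp(−¼γ₀(26^d)⁻¹A₁²p₀²(d(Z)+1))`, `Z = ⋃_{i∈N} (Y i)~⁶`.
[cite: Balaban1989LargeFieldII, p.385 display before (1.82) (exponential comparison; model, six-layer reading)] -/
theorem expProd_le_fam_collar_six {Y : ι → Finset (Pt d)} (hY : ∀ i, (Y i).Nonempty)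
    (hYc : ∀ i, FaceConnected (Y i)) {N : Finset ι} (hN : N.Nonempty)
    (hU : FaceConnected (fam (fun i => collar^[6] (Y i)) N)) {γ₀ A₁ p₀g : ℝ} (hγ : 0 ≤ γ₀) :
    ∏ i ∈ N, Real.exp (-(1 / 2) * γ₀ * A₁ ^ 2 * p₀g ^ 2 * (treeLen (Y i) + 1)) ≤
      Real.exp (-(1 / 4) * γ₀ * (26 ^ d)⁻¹ * A₁ ^ 2 * p₀g ^ 2 *
        (treeLen (fam (fun i => collar^[6] (Y i)) N) + 1)) :=
  expProd_le_const (by positivity) hγ (gluing_fam_collar_six hY hYc hN hU)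

open B16MergeGeometry in
/-- **(1.82) ON THE MODEL WITH NO GEOMETRIC BINDER, six-layer reading**: from the (1.79)-shaped definition of
`κ₁(Z)` alone, `¼γ₀(26^d)⁻¹A₁²p₀²(d(Z) + 1) − cost ≤ κ₁`, `Z = ⋃_{i∈N} (Y i)~⁶` face-connected (print, three
layers: `(14^d)⁻¹`). [cite: Balaban1989LargeFieldII, (1.82) p.385 (model, six-layer reading)] -/
theorem ineq182_fam_collar_six {Y : ι → Finset (Pt d)} (hY : ∀ i, (Y i).Nonempty)
    (hYc : ∀ i, FaceConnected (Y i)) {N : Finset ι} (hN : N.Nonempty)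
    (hU : FaceConnected (fam (fun i => collar^[6] (Y i)) N)) {κ₁ γ₀ A₁ p₀g cost : ℝ} (hγ : 0 ≤ γ₀)
    (hdef : ∑ i ∈ N, (1 / 2) * γ₀ * A₁ ^ 2 * p₀g ^ 2 * (treeLen (Y i) + 1) - cost ≤ κ₁) :
    (1 / 4) * γ₀ * (26 ^ d)⁻¹ * A₁ ^ 2 * p₀g ^ 2 *
        (treeLen (fam (fun i => collar^[6] (Y i)) N) + 1) - cost ≤ κ₁ :=
  ineq182_of_gluing_const (by positivity) hγ hdef (gluing_fam_collar_six hY hYc hN hU)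

open B16MergeGeometry in
/-- **THE BASE CASE `j = 1` OF (1.80) ON THE MODEL, six-layer reading**, no geometric binder:
`Step.Budget.base_182` with `hκ` discharged by `ineq182_fam_collar_six`; the located p. 385 condition
*«¼γ₀(14)^{−d}A₁²p₀²(g₁) ≧ O(1)2(64)^dM^dL^{d+1}R₁^{d+2} … satisfied for p₀ large, and g₁ sufficiently small»*
reads here `2Q ≤ ¼γ₀(26)^{−d}A₁²p₀²(g₁)` — the same clause type with 26 for 14 (constants only).
[cite: Balaban1989LargeFieldII, (1.80)–(1.82) pp.384–385 (model, six-layer reading)] -/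
theorem controls_base_fam_collar_six (b : Step.Budget.Consts) (hbd : b.d = d) {Y : ι → Finset (Pt d)}
    (hY : ∀ i, (Y i).Nonempty) (hYc : ∀ i, FaceConnected (Y i)) {N : Finset ι} (hN : N.Nonempty)
    (hU : FaceConnected (fam (fun i => collar^[6] (Y i)) N)) {κ₁ γ₀ A₁ p₀g Q : ℝ} {K : ℕ}
    {size : ℕ → ℝ} (hγ : 0 ≤ γ₀)
    (hdef : ∑ i ∈ N, (1 / 2) * γ₀ * A₁ ^ 2 * p₀g ^ 2 * (treeLen (Y i) + 1) -
      b.cost 1 (treeLen (fam (fun i => collar^[6] (Y i)) N)) ≤ κ₁)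
    (h181 : ∑ n ∈ Finset.Ioc 1 (1 + K), b.cost n (size n) ≤
      Q * (treeLen (fam (fun i => collar^[6] (Y i)) N) + 1))
    (hcost : b.cost 1 (treeLen (fam (fun i => collar^[6] (Y i)) N)) ≤
      Q * (treeLen (fam (fun i => collar^[6] (Y i)) N) + 1))
    (hcond : 2 * Q ≤ (1 / 4) * γ₀ * (26 ^ b.d)⁻¹ * A₁ ^ 2 * p₀g ^ 2) :
    Step.Budget.Controls b 1 K κ₁ size := by
  subst hbd
  exact Step.Budget.base_182 κ₁ ((1 / 4) * γ₀ * (26 ^ b.d)⁻¹ * A₁ ^ 2 * p₀g ^ 2) Q _ _ _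
    (treeLen_nonneg _) (ineq182_fam_collar_six hY hYc hN hU hγ hdef) h181 hcost hcond

/-- Non-vacuity of the six-layer statements: one cube, `N = {0}` — the union `(□)~⁶` is face-connected and
the gluing consequence holds with room (`d(□~⁶) + 1 ≤ 2·26^d`). [folklore] -/
example : treeLen (B16MergeGeometry.fam (fun _ : Unit => collar^[6] ({(0 : Pt d)} : Finset (Pt d))) {()}) + 1 ≤
    2 * 26 ^ d * ∑ _i ∈ ({()} : Finset Unit), (treeLen (({(0 : Pt d)} : Finset (Pt d))) + 1) := by
  have hY : ∀ _ : Unit, (({(0 : Pt d)} : Finset (Pt d))).Nonempty := fun _ => Finset.singleton_nonempty _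
  have hYc : ∀ _ : Unit, FaceConnected (({(0 : Pt d)} : Finset (Pt d))) := fun _ =>
    fun x hx y hy => by
      rw [Finset.mem_singleton] at hx hy; subst hx; subst hy; exact Relation.ReflTransGen.refl
  have hU : FaceConnected (B16MergeGeometry.fam (fun _ : Unit => collar^[6] ({(0 : Pt d)} : Finset (Pt d))) {()}) := by
    have : B16MergeGeometry.fam (fun _ : Unit => collar^[6] ({(0 : Pt d)} : Finset (Pt d))) {()} =
        collar^[6] ({(0 : Pt d)} : Finset (Pt d)) := by
      simp [B16MergeGeometry.fam]
    rw [this]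
    exact faceConnected_iterate_collar 6 (hYc ())
  exact gluing_fam_collar_six hY hYc (Finset.singleton_nonempty _) hU

end Six

end

end Literature.MathematicalPhysics.QuantumFieldTheory.Balaban1983to89.B16Enlargement385
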